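import Summits.QuantumFields.YangMills.Theorems.BalabanUVNodesK0V22ZDefs
import Summits.QuantumFields.YangMills.Theorems.BalabanUVNodesN07Thm1Top7FromProp8Guarded
import Literature.MathematicalPhysics.QuantumFieldTheory.Balaban1983to89.B11Thm1ExistsUniqueInductionGBridges
import HarnessLib

/-!
# BalabanUVNodes ∕ N12 — BOTH [15]-THEOREM-1 NAMES AT K0⁷'s CURRENCY FROM THE REGISTERED STUB-1 TEXT + THE (E∕U) PRODUCER-SHAPE TOKENS
# ([Balaban1985Variational] Thm 1 (8) p.279, (11)–(14) pp.279–280, Prop. 2 p.281, Prop. 8 p.304; [Balaban1985RegularSpaces] (1.3)–(1.6) p.77; [Balaban1988Convergent] (2.18) p.257)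

Cell `pub-ymgap` (HUMAN RULINGS D-0062 ∕ D-0149), seat `pub-ymgap-dag-n12-d` g29 (R134 N12 [B15] s2 = by-name knit at the record; count-neutral helper of K1⁹ `stmt-QuantumFields-27364`,
`--kind proof --supports … --as helper`).  THEOREMS ONLY (0 `def`, 0 `instance`, 0 `sorry`); composition BY NAME.

WHY.  N12's junctions on K0⁷'s GUARDED currency — L5 ✓p753681 `…WindowDirectDatumScaleOfK0GridGNamedEUOfRecord` and the K0⁷-CURRENCY POINTER L7 ✓p753864
`…LettersDischargedOfK0GridGNamedEUOfRecord` (plan g94 WORD (D2), chair #10982) — display the two [15]-Theorem-1 names at K0⁷'s registered grid guard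
`A‴(c,c₀,c₁) := fun ν M g K k _s => c ≤ ν.M₁ ∧ k + c₀ ≤ F.m + K ∧ F.L^{c₁} ∣ M ∧ ∀ i, 1 ≤ i → i ≤ k → dCubeSide (F.P K).L M (RkOfRecord (F.P K).L ν.r (g i)) i ∣ (F.P K).sitesPerDir 0`
(`K0V22ZDefs.Prop8StepCoPGridGAt` :49–50): `h15G : Node00.VariationalThm1RegSepCoP7MG F 2 A‴ B₃ a₀ a₁'` and `hEUG : B11Thm1ExistsUniqueCoP7MG.VariationalThm1EUSepCoP7MG F 2 A‴ B₃ a₀ a₁'`.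
The first comes from K0⁷'s REGISTERED stub-1 text `K0V22ZDefs.Prop8StepCoPGridGAt F` by dag-n07-e's `variationalThm1RegSepCoP7MG_of_prop8TopStepG` (this seat's L6 ✓p753838); the second had
«NO producer, NO item, NO producer SHAPE» until dag-n12-c g33 typed print's (E∕U) architecture: one-length STEP ∕ length-1 SUPPLY ∕ LIFT tokens (`B11Thm1ExistsUniqueStepTokensG` ✓p755261,
`B11Thm1ExistsUniqueInductionG` ✓p756040) and the k-INDUCTION PROVED (`B11Thm1ExistsUniqueInductionGBridges` ✓p756236: STEP → (R) → SUPPLY → LIFT → truncation-stability of the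
guard → (E∕U)); the guard row was discharged there for K0's FLOOR guard only (`floorGuard_truncSeq`).  THIS FILE discharges it for K0⁷'s GRID guard `A‴` and packages BOTH names.

WHAT THIS FILE PROVES.  §1 `gridGuard_of_succ`: `A‴(c,c₀,c₁)` is TRUNCATION-STABLE along print's induction (`k+1 ↦ k`, `s ↦ truncSeq s`): it does not read `s`, and `k + c₀ ≤ m + K`,
`∀ i ≤ k` weaken.  §2 `variationalThm1EUSepCoP7MG_grid_of_step_of_reg_of_base_of_lift`: the lane's induction at `Adm := A‴` with §1 supplied — (R) at `A‴` + STEP ∕ SUPPLY (`A‴ ∧ k = 1`) ∕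
LIFT at `A‴` ⊢ (E∕U) at `A‴` (generic `N`).  §3 ★★★ `thm1Names_grid_of_prop8StepCoPGridGAt_of_stepTokens`: from `h1 : K0V22ZDefs.Prop8StepCoPGridGAt F` ALONE, ∃ the stub's constants
`(c, c₀, c₁, B₃, a₀, a₁)` with `2L² ≤ B₃`, `0 < a₀`, `0 < a₁`, the (R)-name at `A‴` — AND, for every `C₁`, STEP → SUPPLY → LIFT → the (E∕U)-name at `A‴`.  So «L7 ∘ §3» (resp. «L5 ∘ §3»)
reads N12's whole (J0′)∘direct road at K0⁷'s currency from `Prop8StepCoPGridGAt F` + the three producer-shaped tokens, exactly as this seat's 109 ✓p756673 does at the guard-generic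
junction of record v14ᴸ — without regenerating L5 ∕ L7.

HONEST FRAMING.  By-name composition; `Prop8StepCoPGridGAt F` is K0⁷'s OPEN stub 1 (`stmt-QuantumFields-20541`, NOT landed) and the three tokens have NO producer («INHABITED BY»:
nobody) — everything CONDITIONAL; nothing of Bałaban's asserted; N12 NOT discharged; K0⁷ ∕ K1⁹ OPEN; counts unmoved (typed 28∕28 · discharged 8∕28, 8∕27 excl. NODE O); one finite 𝕋⁴
programme at fixed `ε = L^{-K}` — R4 closes only the conditional rung `BalabanLadder.UV`; nothing continuum ∕ ℝ⁴ ∕ OS; the Yang–Mills mass gap (Clay) is NOT proved by any of this.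
-/

noncomputable section

namespace Summit.QuantumFields.YangMills.BalabanUVNodes.N12Thm1NamesOfK0GridGStepTokens

open Literature.MathematicalPhysics.QuantumFieldTheory.Balaban1983to89
open Literature.MathematicalPhysics.QuantumFieldTheory.Balaban1983to89.Node00
open Literature.MathematicalPhysics.QuantumFieldTheory.Balaban1983to89.T4Continuum
open Literature.MathematicalPhysics.QuantumFieldTheory.Balaban1983to89.FlowStep
open Summit.QuantumFields.YangMills.Theorems.K0V22ZDefs (Prop8StepCoPGridGAt)
open Summit.QuantumFields.YangMills.BalabanUVNodes.N07Thm1Top7FromProp8 (variationalThm1RegSepCoP7MG_of_prop8TopStepG)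
open B11Thm1ExistsUniqueStepTokensG (VariationalThm1EUStepCoP7MG ApproxMinimiserExistsCoP7MG)
open B11Thm1ExistsUniqueInductionG (truncSeq VariationalThm1EULiftCoP7MG variationalThm1EUSepCoP7MG_of_step_of_reg_of_base_of_lift)

variable {F : T4Family}

/-! ## §1  K0⁷'s grid guard `A‴(c,c₀,c₁)` is truncation-stable along print's induction -/

/-- ★ **THE GRID GUARD IS TRUNCATION-STABLE.**  K0⁷'s registered guard `A‴(c,c₀,c₁)` (`K0V22ZDefs.Prop8StepCoPGridGAt` :49–50) read at `(k+1, s)` implies it at `(k, truncSeq s)` — the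
guard does not read the (2.18) index `s` (so the lemma is stated on its `s`-free body), `k + 1 + c₀ ≤ m + K ⇒ k + c₀ ≤ m + K`, and the d-cube divisibility clause for `i ≤ k + 1` covers
`i ≤ k`.  This is the `hAdm` ∕ `hAdmTr` row of the lane's
induction theorem (`…InductionGBridges` ✓p756236) and of this seat's 109 ✓p756673, DISCHARGED at K0's guard. [cite: Balaban1985RegularSpaces, (1.3)–(1.6) p.77; Balaban1988Convergent, (2.18) p.257; Balaban1985Variational, Prop. 8 p.304 (bookkeeping)] -/
theorem gridGuard_of_succ (c c₀ c₁ : ℕ) (ν : Stage7Numerics) (M : ℕ) (g : ℕ → ℝ) (K k : ℕ)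
    (h : c ≤ ν.M₁ ∧ k + 1 + c₀ ≤ F.m + K ∧ F.L ^ c₁ ∣ M ∧
      ∀ i, 1 ≤ i → i ≤ k + 1 → dCubeSide (F.P K).L M (RkOfRecord (F.P K).L ν.r (g i)) i ∣ (F.P K).sitesPerDir 0) :
    c ≤ ν.M₁ ∧ k + c₀ ≤ F.m + K ∧ F.L ^ c₁ ∣ M ∧
      ∀ i, 1 ≤ i → i ≤ k → dCubeSide (F.P K).L M (RkOfRecord (F.P K).L ν.r (g i)) i ∣ (F.P K).sitesPerDir 0 :=
  ⟨h.1, by have := h.2.1; omega, h.2.2.1, fun i h1 hi => h.2.2.2 i h1 (Nat.le_succ_of_le hi)⟩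

/-! ## §2  The lane's induction at `Adm := A‴`: (R) + STEP ∕ SUPPLY ∕ LIFT ⊢ (E∕U), the guard row supplied by §1 -/

/-- ★★ **(E∕U) AT K0⁷'s GRID GUARD FROM (R) + THE THREE TOKENS** (generic `N`): dag-n12-c g33's kernel-checked k-induction `variationalThm1EUSepCoP7MG_of_step_of_reg_of_base_of_lift` at
`Adm := A‴(c,c₀,c₁)`, its truncation-stability row discharged by §1 — the GRID twin of the lane's `…_floorGuard_of_step_of_reg_of_base_of_lift`.  CONDITIONAL (no producer for any token).
[cite: Balaban1985Variational, Thm 1 p.279, (11)–(14) pp.279–280, Prop. 2 p.281; Balaban1988Convergent, (2.12) p.256, (2.18) p.257] -/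
theorem variationalThm1EUSepCoP7MG_grid_of_step_of_reg_of_base_of_lift {N : ℕ} [NeZero N] (c c₀ c₁ : ℕ) {C₁ B₃ a₀ a₁ : ℝ}
    (hstep : VariationalThm1EUStepCoP7MG F N
      (fun ν M g K k _s => c ≤ ν.M₁ ∧ k + c₀ ≤ F.m + K ∧ F.L ^ c₁ ∣ M ∧
        ∀ i, 1 ≤ i → i ≤ k → dCubeSide (F.P K).L M (RkOfRecord (F.P K).L ν.r (g i)) i ∣ (F.P K).sitesPerDir 0) C₁ B₃ a₀ a₁)
    (hR : VariationalThm1RegSepCoP7MG F N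
      (fun ν M g K k _s => c ≤ ν.M₁ ∧ k + c₀ ≤ F.m + K ∧ F.L ^ c₁ ∣ M ∧
        ∀ i, 1 ≤ i → i ≤ k → dCubeSide (F.P K).L M (RkOfRecord (F.P K).L ν.r (g i)) i ∣ (F.P K).sitesPerDir 0) B₃ a₀ a₁)
    (hbase : ApproxMinimiserExistsCoP7MG F N
      (fun ν M g K k _s => (c ≤ ν.M₁ ∧ k + c₀ ≤ F.m + K ∧ F.L ^ c₁ ∣ M ∧
        ∀ i, 1 ≤ i → i ≤ k → dCubeSide (F.P K).L M (RkOfRecord (F.P K).L ν.r (g i)) i ∣ (F.P K).sitesPerDir 0) ∧ k = 1) C₁ B₃ a₀ a₁)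
    (hlift : VariationalThm1EULiftCoP7MG F N
      (fun ν M g K k _s => c ≤ ν.M₁ ∧ k + c₀ ≤ F.m + K ∧ F.L ^ c₁ ∣ M ∧
        ∀ i, 1 ≤ i → i ≤ k → dCubeSide (F.P K).L M (RkOfRecord (F.P K).L ν.r (g i)) i ∣ (F.P K).sitesPerDir 0) C₁ B₃ a₀ a₁) :
    B11Thm1ExistsUniqueCoP7MG.VariationalThm1EUSepCoP7MG F N
      (fun ν M g K k _s => c ≤ ν.M₁ ∧ k + c₀ ≤ F.m + K ∧ F.L ^ c₁ ∣ M ∧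
        ∀ i, 1 ≤ i → i ≤ k → dCubeSide (F.P K).L M (RkOfRecord (F.P K).L ν.r (g i)) i ∣ (F.P K).sitesPerDir 0) B₃ a₀ a₁ :=
  variationalThm1EUSepCoP7MG_of_step_of_reg_of_base_of_lift hstep hR hbase hlift
    fun ν M g K k _s _ h => gridGuard_of_succ (F := F) c c₀ c₁ ν M g K k h

/-! ## §3  Both names at K0⁷'s currency from the registered stub-1 text + the three tokens -/

/-- ★★★ **BOTH [15]-THEOREM-1 NAMES AT K0⁷'s CURRENCY FROM `Prop8StepCoPGridGAt F` + STEP ∕ SUPPLY ∕ LIFT.**  From K0⁷'s REGISTERED stub-1 text alone (`stmt-QuantumFields-20541`, OPEN):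
the stub's constants `(c, c₀, c₁, B₃, a₀, a₁)` with `2L² ≤ B₃`, `0 < a₀`, `0 < a₁`, the (R)-name `Node00.VariationalThm1RegSepCoP7MG F 2 A‴ B₃ a₀ a₁` (dag-n07-e's bridge; = L5's `h15G`,
L6 ✓p753838's terminus) AND, for every `C₁`, the (E∕U)-name `B11Thm1ExistsUniqueCoP7MG.VariationalThm1EUSepCoP7MG F 2 A‴ B₃ a₀ a₁` (= L5 ∕ L7's `hEUG`) GIVEN dag-n12-c g33's one-length
STEP token, the SUPPLY token at length 1 (guard `A‴ ∧ k = 1`) and the LIFT token at the same constants (§2).  Hence «L7 ✓p753864 ∘ this» = N12's (J0′)∘direct road at K0⁷'s currency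
from the stub text + three producer-shaped tokens («INHABITED BY»: nobody — CONDITIONAL; count-neutral; NOT a discharge of N12).
[cite: Balaban1985Variational, Thm 1 (8) p.279, (11)–(14) pp.279–280, Prop. 2 p.281, Prop. 8 p.304, (141)–(142) p.299; Balaban1985RegularSpaces, (1.3)–(1.6) p.77; Balaban1988Convergent, (2.12) p.256, (2.18) p.257] -/
theorem thm1Names_grid_of_prop8StepCoPGridGAt_of_stepTokens (h1 : Prop8StepCoPGridGAt F) :
    ∃ (c c₀ c₁ : ℕ) (B₃ a₀ a₁ : ℝ), 2 * (F.L : ℝ) ^ 2 ≤ B₃ ∧ 0 < a₀ ∧ 0 < a₁ ∧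
      VariationalThm1RegSepCoP7MG F 2
        (fun ν M g K k _s => c ≤ ν.M₁ ∧ k + c₀ ≤ F.m + K ∧ F.L ^ c₁ ∣ M ∧
          ∀ i, 1 ≤ i → i ≤ k → dCubeSide (F.P K).L M (RkOfRecord (F.P K).L ν.r (g i)) i ∣ (F.P K).sitesPerDir 0) B₃ a₀ a₁ ∧
      ∀ C₁ : ℝ,
        VariationalThm1EUStepCoP7MG F 2
          (fun ν M g K k _s => c ≤ ν.M₁ ∧ k + c₀ ≤ F.m + K ∧ F.L ^ c₁ ∣ M ∧
            ∀ i, 1 ≤ i → i ≤ k → dCubeSide (F.P K).L M (RkOfRecord (F.P K).L ν.r (g i)) i ∣ (F.P K).sitesPerDir 0) C₁ B₃ a₀ a₁ →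
        ApproxMinimiserExistsCoP7MG F 2
          (fun ν M g K k _s => (c ≤ ν.M₁ ∧ k + c₀ ≤ F.m + K ∧ F.L ^ c₁ ∣ M ∧
            ∀ i, 1 ≤ i → i ≤ k → dCubeSide (F.P K).L M (RkOfRecord (F.P K).L ν.r (g i)) i ∣ (F.P K).sitesPerDir 0) ∧ k = 1) C₁ B₃ a₀ a₁ →
        VariationalThm1EULiftCoP7MG F 2
          (fun ν M g K k _s => c ≤ ν.M₁ ∧ k + c₀ ≤ F.m + K ∧ F.L ^ c₁ ∣ M ∧
            ∀ i, 1 ≤ i → i ≤ k → dCubeSide (F.P K).L M (RkOfRecord (F.P K).L ν.r (g i)) i ∣ (F.P K).sitesPerDir 0) C₁ B₃ a₀ a₁ →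
        B11Thm1ExistsUniqueCoP7MG.VariationalThm1EUSepCoP7MG F 2
          (fun ν M g K k _s => c ≤ ν.M₁ ∧ k + c₀ ≤ F.m + K ∧ F.L ^ c₁ ∣ M ∧
            ∀ i, 1 ≤ i → i ≤ k → dCubeSide (F.P K).L M (RkOfRecord (F.P K).L ν.r (g i)) i ∣ (F.P K).sitesPerDir 0) B₃ a₀ a₁ := by
  obtain ⟨c, c₀, c₁, B₃, a₀, a₁, hB₃, ha₀, ha₁, h8⟩ := h1
  have hL : (0 : ℝ) < F.L := by exact_mod_cast (show 0 < F.L by have := F.hL.2; omega)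
  have hB : 0 < B₃ := lt_of_lt_of_le (by positivity) hB₃
  have hR := variationalThm1RegSepCoP7MG_of_prop8TopStepG hB h8
  exact ⟨c, c₀, c₁, B₃, a₀, a₁, hB₃, ha₀, ha₁, hR, fun C₁ hstep hbase hlift =>
    variationalThm1EUSepCoP7MG_grid_of_step_of_reg_of_base_of_lift c c₀ c₁ hstep hR hbase hlift⟩

end Summit.QuantumFields.YangMills.BalabanUVNodes.N12Thm1NamesOfK0GridGStepTokens

end
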